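import Literature.Geometry.Symplectic.SurfaceTubeMoserField
import Literature.Geometry.Symplectic.OrigamiMoserCalculus
import Literature.Topology.FourManifolds.SlabFlow
import Literature.Geometry.Manifold.TimeDependentFlowIcc
import Mathlib.Analysis.SpecialFunctions.SmoothTransition
import Mathlib.Geometry.Manifold.PartitionOfUnity
import HarnessLib

/-!
# The Moser flow of the tube of a symplectic surface

Topic `Literature/Geometry/Symplectic`; layer C6b of the construction of the symplectic tubular
neighbourhood with its `U(1)`-structure of a closed symplectic surface `b : S → N` in a compact
symplectic `4`-manifold (McLean, GAFA 2012, **Lemma 5.14**, `k = 1`; the symplectic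
neighbourhood theorem, McDuff–Salamon 2017, Thm. 3.4.10, by Moser's argument, §3.2), for the
fact seat of `Literature.Geometry.Symplectic.mclean_divisorComplement_convex_four`.

With the Moser field `Y_t` of `SurfaceTubeMoserField.lean` (`ι(Y_t) s_t = -β`, `dβ = s - s_M`,
`s_t = s_M + t (s - s_M)`), this file runs **Moser's argument** (McDuff–Salamon 2017, §3.2) on
the tube, following the tree's template `GrayStabilityFlow.lean`:

* `timeCut`, `Setup.χ` — cut-offs in time (`= 1` on `[-1/4, 5/4]`, `= 0` off `[-1/2, 3/2]`) and
  in space (`= 1` on the closed tube `Tbar (ε₂/2)`, `= 0` off `T ε₂`, `Tbar ε₂ ⊆ O₂`);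
* `Setup.G` — the cut-off Moser field, a global smooth time-dependent vector field
  (`contMDiff_G`), vanishing on the surface;
* `Setup.Ψ` — its flow, an ambient isotopy of `N` (tree:
  `exists_ambientIsotopy_of_timeDependent`, Hirsch 1976, Ch. 8 §1), fixing the surface pointwise
  (`Ψ_b`);
* the flow equation and the pairing `s_t (Ψ_t y) [TΨ_t v, TΨ_t w]` read in charts
  (`pairing₂_eq_trackPairing₂`), the identities `∂_t Â = dβ̂`, `dÂ = 0` of the representatives,
  and `f' = 0` by the tree's `OrigamiMoser.hasDerivAt_trackPairing₂`;
* **`moser_pullback`** — for `y` in the open neighbourhood `O₄ ⊇ b(S)` of points whose track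
  stays in the inner tube during `[0, 1]`:
  `s (Ψ₁ y) [TΨ₁ v, TΨ₁ w] = s_M y [v, w]`, i.e. `Ψ₁^* s = s_M` near the surface.

Everything here is proved; no named facts (D-0026).

## References

* D. McDuff, D. Salamon, *Introduction to Symplectic Topology*, 3rd ed. (2017), §3.2 (Moser's
  argument), Thm. 3.4.10. [McDuffSalamon2017]
* M. McLean, *The growth rate of symplectic homology and affine varieties*, GAFA 22 (2012),
  Lemma 5.14 (arXiv:1011.2542). [Mclean2012]
* M. W. Hirsch, *Differential Topology* (1976), Ch. 8 §1, Thms. 1.1–1.2. [HirschDT1976]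
-/

noncomputable section

open scoped Manifold ContDiff Topology
open Set Function Module Filter Metric Bundle
open Literature.Topology.FourManifolds
open Literature.Geometry.Kaehler
open Literature.Geometry.Manifold

namespace Literature.Geometry.Symplectic

namespace SurfaceTube

/-- Local notation for the model space. -/
local notation "E4" => EuclideanSpace ℝ (Fin 4)

/-! ### The time cut-off -/

/-- **The time cut-off**: `1` on `[-1/4, 5/4]`, `0` off `(-1/2, 3/2)`. [folklore] -/
def timeCut (t : ℝ) : ℝ := Real.smoothTransition (4 * t + 2) * Real.smoothTransition (6 - 4 * t)

/-- The time cut-off is `1` on `[-1/4, 5/4]`. [folklore] -/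
theorem timeCut_eq_one {t : ℝ} (ht : t ∈ Icc (-(1 / 4) : ℝ) (5 / 4)) : timeCut t = 1 := by
  rw [timeCut, Real.smoothTransition.one_of_one_le (by linarith [ht.1]),
    Real.smoothTransition.one_of_one_le (by linarith [ht.2]), mul_one]

/-- The time cut-off vanishes off `(-1/2, 3/2)`. [folklore] -/
theorem timeCut_eq_zero {t : ℝ} (ht : t ∉ Ioo (-(1 / 2) : ℝ) (3 / 2)) : timeCut t = 0 := by
  rw [mem_Ioo, not_and_or, not_lt, not_lt] at ht
  rcases ht with h | h
  · rw [timeCut, Real.smoothTransition.zero_of_nonpos (by linarith), zero_mul]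
  · rw [timeCut, Real.smoothTransition.zero_of_nonpos (x := 6 - 4 * t) (by linarith), mul_zero]
 
/-- The time cut-off is smooth. [folklore] -/
theorem contDiff_timeCut : ContDiff ℝ ∞ timeCut :=
  (Real.smoothTransition.contDiff.comp ((contDiff_const.mul contDiff_id).add contDiff_const)).mul
    (Real.smoothTransition.contDiff.comp (contDiff_const.sub (contDiff_const.mul contDiff_id)))

variable {N : Type*} [TopologicalSpace N] [ChartedSpace (EuclideanSpace ℝ (Fin 4)) N]
  [IsManifold (𝓡 4) ∞ N] {S : Type*} [TopologicalSpace S] [ChartedSpace (EuclideanSpace ℝ (Fin 2)) S]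
  [IsManifold (𝓡 2) ∞ S] {V : Type*} [NormedAddCommGroup V] [InnerProductSpace ℝ V]
  [FiniteDimensional ℝ V] (D : Setup N S V)

namespace Setup

variable [CompactSpace S] [Nonempty S] [T2Space S]

section Level

variable [T2Space N]

/-- A tube level `ε₂` with `Tbar ε₂ ⊆ O₂`. [folklore] -/
theorem exists_level : ∃ ε : ℝ, 0 < ε ∧ ε < D.εc ∧ D.Tbar ε ⊆ D.O₂ :=
  D.exists_Tbar_subset D.isOpen_O₂ D.range_b_subset_O₂

/-- **The level `ε₂`** of the cut-off tube. [folklore] -/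
def ε₂ : ℝ := D.exists_level.choose

/-- `0 < ε₂`. [folklore] -/
theorem ε₂_pos : 0 < D.ε₂ := D.exists_level.choose_spec.1

/-- `ε₂ < εc`. [folklore] -/
theorem ε₂_lt : D.ε₂ < D.εc := D.exists_level.choose_spec.2.1

/-- `Tbar ε₂ ⊆ O₂`. [folklore] -/
theorem Tbar_subset_O₂ : D.Tbar D.ε₂ ⊆ D.O₂ := D.exists_level.choose_spec.2.2

/-- The inner open tube `T (ε₂/2)` lies in `O₂`. [folklore] -/
theorem Tin_subset_O₂ : D.T (D.ε₂ / 2) ⊆ D.O₂ := fun _ hx ↦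
  D.Tbar_subset_O₂ ⟨hx.1, by linarith [hx.2, D.ε₂_pos]⟩

end Level

section Reps

/-! ### Identities of the representatives -/

/-- **The Moser field read in the chart** at `x₀`: `X̂ (t, q) = moserE4 (Â (t, q)) (β̂ q)`. [folklore] -/
def Xrep (x₀ : N) (z : ℝ × E4) : E4 := moserE4 (D.Arep x₀ z) (D.Brep x₀ z.2)

omit [T2Space S] in
/-- The `t`-derivative of `Â` is `τ̂`. [folklore] -/
theorem fderiv_Arep_one_zero (x₀ : N) {z : ℝ × E4} (hz : z.2 ∈ D.tgt₁ x₀) :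
    fderiv ℝ (D.Arep x₀) z (1, 0) = D.τ.inChart x₀ z.2 := by
  obtain ⟨s, q⟩ := z
  have hd : HasFDerivAt (D.Arep x₀) (fderiv ℝ (D.Arep x₀) (s, q)) (s, q) :=
    ((D.contDiffAt_Arep x₀ hz).differentiableAt (by simp)).hasFDerivAt
  have hc : HasDerivAt (fun s' : ℝ ↦ ((s', q) : ℝ × E4)) ((1 : ℝ), (0 : E4)) s :=
    (hasDerivAt_id s).prodMk (hasDerivAt_const s q)
  have h1 := hd.comp_hasDerivAt s hc
  have h2 : HasDerivAt (fun s' : ℝ ↦ D.Arep x₀ (s', q)) (D.τ.inChart x₀ q) s := by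
    have : (fun s' : ℝ ↦ D.Arep x₀ (s', q)) = fun s' ↦ D.sM.inChart x₀ q + s' • D.τ.inChart x₀ q := by
      funext s'; exact D.Arep_eq_add x₀ (s', q)
    rw [this]
    simpa using ((hasDerivAt_id s).smul_const (D.τ.inChart x₀ q)).const_add (D.sM.inChart x₀ q)
  exact h1.unique h2

omit [T2Space S] in
/-- Partial derivatives of `Â` in `q` are derivatives of the slice. [folklore] -/
theorem fderiv_Arep_zero (x₀ : N) {z : ℝ × E4} (hz : z.2 ∈ D.tgt₁ x₀) (a : E4) :
    fderiv ℝ (D.Arep x₀) z (0, a) = fderiv ℝ ((D.sFam z.1).inChart x₀) z.2 a := by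
  obtain ⟨s, q⟩ := z
  have hd : DifferentiableAt ℝ (D.Arep x₀) (s, q) := (D.contDiffAt_Arep x₀ hz).differentiableAt (by simp)
  have hcomp : HasFDerivAt (fun q' ↦ D.Arep x₀ (s, q'))
      ((fderiv ℝ (D.Arep x₀) (s, q)).comp (ContinuousLinearMap.inr ℝ ℝ E4)) q :=
    hd.hasFDerivAt.comp q (hasFDerivAt_prodMk_right s q)
  have : (fun q' ↦ D.Arep x₀ (s, q')) = (D.sFam s).inChart x₀ := rfl
  rw [this] at hcomp
  rw [hcomp.fderiv]
  rfl

/-- The representative of `β` as a function of `(t, q)` (time-independent). [folklore] -/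
def Mrep (x₀ : N) (z : ℝ × E4) : E4 [⋀^Fin 1]→L[ℝ] ℝ := D.Brep x₀ z.2

/-- `Mrep` is `C^∞` on `ℝ × tgtq`. [folklore] -/
theorem contDiffAt_Mrep (x₀ : N) {z : ℝ × E4} (hz : z.2 ∈ D.tgtq x₀) : ContDiffAt ℝ ∞ (D.Mrep x₀) z :=
  (D.contDiffAt_Brep x₀ hz).comp z contDiffAt_snd

/-- Partial derivatives of `Mrep` in `q`. [folklore] -/
theorem fderiv_Mrep_zero (x₀ : N) {z : ℝ × E4} (hz : z.2 ∈ D.tgtq x₀) (a : E4) :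
    fderiv ℝ (D.Mrep x₀) z (0, a) = fderiv ℝ (D.Brep x₀) z.2 a := by
  obtain ⟨s, q⟩ := z
  have hd : DifferentiableAt ℝ (D.Mrep x₀) (s, q) := (D.contDiffAt_Mrep x₀ hz).differentiableAt (by simp)
  have hcomp : HasFDerivAt (fun q' ↦ D.Mrep x₀ (s, q'))
      ((fderiv ℝ (D.Mrep x₀) (s, q)).comp (ContinuousLinearMap.inr ℝ ℝ E4)) q :=
    hd.hasFDerivAt.comp q (hasFDerivAt_prodMk_right s q)
  have : (fun q' ↦ D.Mrep x₀ (s, q')) = D.Brep x₀ := rfl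
  rw [this] at hcomp
  rw [hcomp.fderiv]
  rfl

/-- **`∂_t Â = dβ̂`** in the chart (from `dβ = τ` on the quarter tube):
`τ̂(q)(a, b) = (Dβ̂ · a)(b) - (Dβ̂ · b)(a)`. [folklore] -/
theorem Arep_dot (x₀ : N) {z : ℝ × E4} (hz : z.2 ∈ D.tgtq x₀) (a b : E4) :
    fderiv ℝ (D.Arep x₀) z (1, 0) ![a, b] =
      fderiv ℝ (D.Mrep x₀) z (0, a) ![b] - fderiv ℝ (D.Mrep x₀) z (0, b) ![a] := by
  rw [D.fderiv_Arep_one_zero x₀ (D.tgtq_subset_tgt₁ x₀ hz), D.fderiv_Mrep_zero x₀ hz,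
    D.fderiv_Mrep_zero x₀ hz]
  have hsm : D.β.SmoothAt ((extChartAt (𝓡 4) x₀).symm z.2) := D.smoothAt_β hz.2
  have h1 : D.τ.inChart x₀ z.2 = extDeriv (D.Brep x₀) z.2 := by
    have hτ : D.τ.inChart x₀ z.2 = (mextDeriv D.β).inChart x₀ z.2 := by
      rw [MForm.inChart_eq_of_mem_target _ hz.1, MForm.inChart_eq_of_mem_target _ hz.1,
        D.mextDeriv_β hz.2]
    rw [hτ, inChart_mextDeriv_of_mem_target D.β hz.1 hsm, ModelWithCorners.range_eq_univ,
      extDerivWithin_univ]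
    rfl
  have hdiff : DifferentiableAt ℝ (D.Brep x₀) z.2 := (D.contDiffAt_Brep x₀ hz).differentiableAt (by simp)
  have hpart : ∀ c x : E4, fderiv ℝ (fun q' ↦ D.Brep x₀ q' ![c]) z.2 x =
      fderiv ℝ (D.Brep x₀) z.2 x ![c] := fun c x ↦
    fderiv_continuousAlternatingMap_apply_const_apply hdiff ![c] x
  have e0 : Fin.removeNth (0 : Fin 2) (![a, b] : Fin 2 → E4) = ![b] := by
    funext i; fin_cases i; rfl
  have e1 : Fin.removeNth (1 : Fin 2) (![a, b] : Fin 2 → E4) = ![a] := by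
    funext i; fin_cases i; rfl
  rw [h1, extDeriv_apply hdiff, Fin.sum_univ_two, e0, e1]
  simp only [Fin.val_zero, pow_zero, one_smul, Fin.val_one, pow_one, neg_smul,
    Matrix.cons_val_zero, Matrix.cons_val_one, Matrix.cons_val_fin_one, hpart]
  ring

omit [T2Space S] in
/-- **`dÂ = 0`** in the chart (closedness of `s_t` on `N₁`). [folklore] -/
theorem Arep_closed (x₀ : N) {z : ℝ × E4} (hz : z.2 ∈ D.tgt₁ x₀) (a b c : E4) :
    fderiv ℝ (D.Arep x₀) z (0, a) ![b, c] - fderiv ℝ (D.Arep x₀) z (0, b) ![a, c] +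
      fderiv ℝ (D.Arep x₀) z (0, c) ![a, b] = 0 := by
  rw [D.fderiv_Arep_zero x₀ hz, D.fderiv_Arep_zero x₀ hz, D.fderiv_Arep_zero x₀ hz]
  have hsm : (D.sFam z.1).SmoothAt ((extChartAt (𝓡 4) x₀).symm z.2) := D.smoothAt_sFam z.1 hz.2
  have hcl : (mextDeriv (D.sFam z.1)).inChart x₀ z.2 = 0 := by
    rw [MForm.inChart_eq_of_mem_target _ hz.1, D.mextDeriv_sFam z.1 hz.2]
    ext u
    rfl
  have h1 : extDeriv ((D.sFam z.1).inChart x₀) z.2 = 0 := by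
    rw [← hcl, inChart_mextDeriv_of_mem_target _ hz.1 hsm, ModelWithCorners.range_eq_univ,
      extDerivWithin_univ]
  have hdiff : DifferentiableAt ℝ ((D.sFam z.1).inChart x₀) z.2 :=
    (contDiffAt_inChart_of_smoothAt x₀ hz.1 hsm).differentiableAt (by simp)
  have hpart : ∀ (u : Fin 2 → E4) (x : E4), fderiv ℝ (fun q' ↦ (D.sFam z.1).inChart x₀ q' u) z.2 x =
      fderiv ℝ ((D.sFam z.1).inChart x₀) z.2 x u := fun u x ↦
    fderiv_continuousAlternatingMap_apply_const_apply hdiff u x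
  have e0 : Fin.removeNth (0 : Fin 3) (![a, b, c] : Fin 3 → E4) = ![b, c] := by
    funext i; fin_cases i <;> rfl
  have e1 : Fin.removeNth (1 : Fin 3) (![a, b, c] : Fin 3 → E4) = ![a, c] := by
    funext i; fin_cases i <;> rfl
  have e2 : Fin.removeNth (2 : Fin 3) (![a, b, c] : Fin 3 → E4) = ![a, b] := by
    funext i; fin_cases i <;> rfl
  have h : extDeriv ((D.sFam z.1).inChart x₀) z.2 ![a, b, c] = 0 := by rw [h1]; rfl
  rw [extDeriv_apply hdiff, Fin.sum_univ_three, e0, e1, e2] at h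
  simp only [Fin.val_zero, pow_zero, one_smul, Fin.val_one, pow_one, neg_smul, Fin.val_two,
    Matrix.cons_val_zero, Matrix.cons_val_one, Matrix.cons_val_two, Matrix.tail_cons,
    Matrix.head_cons, hpart] at h
  norm_num at h
  linarith [h]

/-- The Moser equation of the representatives near a good chart point. [folklore] -/
theorem Arep_Xrep (x₀ : N) {z : ℝ × E4} (ht : z.1 ∈ Itime) (hz : z.2 ∈ (extChartAt (𝓡 4) x₀).target)
    (hO : (extChartAt (𝓡 4) x₀).symm z.2 ∈ D.O₂) (u : E4) :
    D.Arep x₀ z ![D.Xrep x₀ z, u] = -D.Mrep x₀ z ![u] := by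
  have hP : pfaffian (D.Arep x₀ z) ≠ 0 := by
    have hzs : (extChartAt (𝓡 4) x₀).symm z.2 ∈ (extChartAt (𝓡 4) x₀).source :=
      (extChartAt (𝓡 4) x₀).map_target hz
    have h := (D.pfaffian_Arep_ne_zero_iff x₀ z.1 hzs).2 (D.pfaffian_sFam_ne_zero hO ht)
    rwa [(extChartAt (𝓡 4) x₀).right_inv hz] at h
  exact alt_two_moserE4 hP _ u

end Reps

section Flow

variable [T2Space N] [CompactSpace N]

/-! ### The space cut-off -/

/-- Existence of the space cut-off. [folklore] -/
theorem exists_spaceCut : ∃ χ : N → ℝ, ContMDiff (𝓡 4) 𝓘(ℝ, ℝ) ∞ χ ∧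
    (∀ x ∈ D.Tbar (D.ε₂ / 2), χ x = 1) ∧ (∀ x ∉ D.T D.ε₂, χ x = 0) := by
  have hε : D.ε₂ / 2 < D.εc := by linarith [D.ε₂_lt, D.ε₂_pos]
  obtain ⟨f, h0, h1, -⟩ := exists_contMDiffMap_zero_one_of_isClosed (I := 𝓡 4) (n := (⊤ : ℕ∞))
    (D.isOpen_T D.ε₂).isClosed_compl (D.isClosed_Tbar hε)
    (disjoint_compl_left_iff_subset.2 (D.Tbar_subset_T (by linarith [D.ε₂_pos])))
  exact ⟨f, f.contMDiff, fun x hx ↦ h1 hx, fun x hx ↦ h0 hx⟩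

/-- **The space cut-off** `χ`: `1` on `Tbar (ε₂/2)`, `0` off `T ε₂`. [folklore] -/
def χ : N → ℝ := D.exists_spaceCut.choose

/-- `χ` is smooth. [folklore] -/
theorem contMDiff_χ : ContMDiff (𝓡 4) 𝓘(ℝ, ℝ) ∞ D.χ := D.exists_spaceCut.choose_spec.1

/-- `χ = 1` on `Tbar (ε₂/2)`. [folklore] -/
theorem χ_eq_one {x : N} (hx : x ∈ D.Tbar (D.ε₂ / 2)) : D.χ x = 1 := D.exists_spaceCut.choose_spec.2.1 x hx

/-- `χ = 0` off `T ε₂`. [folklore] -/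
theorem χ_eq_zero {x : N} (hx : x ∉ D.T D.ε₂) : D.χ x = 0 := D.exists_spaceCut.choose_spec.2.2 x hx

/-! ### The cut-off Moser field and its flow -/

/-- **The cut-off Moser field** `G (t, x) = timeCut t • χ x • Y_t x`. [folklore] -/
def G (p : ℝ × N) : TangentSpace (𝓡 4) p.2 := (timeCut p.1 * D.χ p.2) • D.Y p.1 p.2

/-- The cut-off field is the Moser field for `t ∈ [-1/4, 5/4]` and `x ∈ Tbar (ε₂/2)`. [folklore] -/
theorem G_eq_Y {p : ℝ × N} (ht : p.1 ∈ Icc (-(1 / 4) : ℝ) (5 / 4)) (hx : p.2 ∈ D.Tbar (D.ε₂ / 2)) :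
    D.G p = D.Y p.1 p.2 := by
  rw [G, timeCut_eq_one ht, D.χ_eq_one hx, one_mul, one_smul]

/-- The cut-off field vanishes for `t ∉ (-1/2, 3/2)`. [folklore] -/
theorem G_eq_zero_of_time {p : ℝ × N} (ht : p.1 ∉ Ioo (-(1 / 2) : ℝ) (3 / 2)) : D.G p = 0 := by
  rw [G, timeCut_eq_zero ht, zero_mul, zero_smul]

/-- The cut-off field vanishes off `T ε₂`. [folklore] -/
theorem G_eq_zero_of_space {p : ℝ × N} (hx : p.2 ∉ D.T D.ε₂) : D.G p = 0 := by
  rw [G, D.χ_eq_zero hx, mul_zero, zero_smul]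

/-- The cut-off field vanishes on the surface. [folklore] -/
theorem G_b (t : ℝ) (y : S) : D.G (t, D.b y) = 0 := by
  rw [G]
  show (timeCut t * D.χ (D.b y)) • D.Y t (D.b y) = 0
  rw [D.Y_b, smul_zero]

/-- **The cut-off Moser field is a smooth time-dependent vector field on `ℝ × N`.** [folklore] -/
theorem contMDiff_G : ContMDiff (𝓘(ℝ, ℝ).prod (𝓡 4)) (𝓡 4).tangent ∞
    (fun p : ℝ × N ↦ (⟨p.2, D.G p⟩ : TangentBundle (𝓡 4) N)) := by
  intro p
  have hscal : ContMDiff (𝓘(ℝ, ℝ).prod (𝓡 4)) 𝓘(ℝ, ℝ) ∞ (fun p : ℝ × N ↦ timeCut p.1 * D.χ p.2) :=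
    (contDiff_timeCut.contMDiff.comp contMDiff_fst).mul (D.contMDiff_χ.comp contMDiff_snd)
  by_cases hx : p.2 ∈ D.Tbar D.ε₂
  · by_cases ht : p.1 ∈ Ioo (-1 : ℝ) 2
    · -- on `(-1, 2) × O₂` the Moser field is smooth
      have hO : IsOpen (Ioo (-1 : ℝ) 2 ×ˢ D.O₂) := isOpen_Ioo.prod D.isOpen_O₂
      have hmem : p ∈ Ioo (-1 : ℝ) 2 ×ˢ D.O₂ := ⟨ht, D.Tbar_subset_O₂ hx⟩
      have hY := (D.contMDiffOn_Y p hmem).contMDiffAt (hO.mem_nhds hmem)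
      exact (ContMDiffWithinAt.smul_tangentVector (hscal p).contMDiffWithinAt
        (hY.contMDiffWithinAt (s := univ))).contMDiffAt univ_mem
    · -- near `p` the time cut-off vanishes
      have hev : (fun p : ℝ × N ↦ (⟨p.2, D.G p⟩ : TangentBundle (𝓡 4) N)) =ᶠ[𝓝 p]
          fun p ↦ ⟨p.2, 0⟩ := by
        have hcl : IsClosed (Icc (-(1 / 2) : ℝ) (3 / 2) ×ˢ (univ : Set N)) :=
          isClosed_Icc.prod isClosed_univ
        have hp : p ∉ Icc (-(1 / 2) : ℝ) (3 / 2) ×ˢ (univ : Set N) := fun h ↦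
          ht ⟨by linarith [h.1.1], by linarith [h.1.2]⟩
        filter_upwards [hcl.isOpen_compl.mem_nhds hp] with q hq
        have hq' : q.1 ∉ Ioo (-(1 / 2) : ℝ) (3 / 2) := fun h ↦ hq ⟨Ioo_subset_Icc_self h, mem_univ _⟩
        rw [D.G_eq_zero_of_time hq']
      refine ContMDiffAt.congr_of_eventuallyEq ?_ hev
      exact (contMDiff_zeroSection ℝ (TangentSpace (𝓡 4) : N → Type _)).contMDiffAt.comp p contMDiffAt_snd
  · -- near `p` the space cut-off vanishes
    have hev : (fun p : ℝ × N ↦ (⟨p.2, D.G p⟩ : TangentBundle (𝓡 4) N)) =ᶠ[𝓝 p]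
        fun p ↦ ⟨p.2, 0⟩ := by
      have hcl : IsClosed ((univ : Set ℝ) ×ˢ D.Tbar D.ε₂) := isClosed_univ.prod (D.isClosed_Tbar D.ε₂_lt)
      have hp : p ∉ (univ : Set ℝ) ×ˢ D.Tbar D.ε₂ := fun h ↦ hx h.2
      filter_upwards [hcl.isOpen_compl.mem_nhds hp] with q hq
      have hq' : q.2 ∉ D.T D.ε₂ := fun h ↦ hq ⟨mem_univ _, D.T_subset_Tbar _ h⟩
      rw [D.G_eq_zero_of_space hq']
    refine ContMDiffAt.congr_of_eventuallyEq ?_ hev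
    exact (contMDiff_zeroSection ℝ (TangentSpace (𝓡 4) : N → Type _)).contMDiffAt.comp p contMDiffAt_snd

/-- **The cut-off Moser field generates an ambient isotopy** (tree: Hirsch 1976, Ch. 8 §1).
[cite: HirschDT1976, Ch. 8 §1, Thms. 1.1–1.2] -/
theorem exists_flow : ∃ Ψ : AmbientIsotopy (𝓡 4) N, ∀ y, IsMIntegralCurve (I := 𝓘(ℝ, ℝ).prod (𝓡 4))
    (fun s ↦ ((s, Ψ.toFun s y) : ℝ × N))
    (fun p : ℝ × N ↦ (((1 : ℝ), D.G p) : TangentSpace (𝓘(ℝ, ℝ).prod (𝓡 4)) p)) :=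
  exists_ambientIsotopy_of_timeDependent (a := -1) (b := 2) D.contMDiff_G fun p hp ↦
    D.G_eq_zero_of_time fun h ↦ hp ⟨by linarith [h.1], by linarith [h.2]⟩

/-- **The Moser isotopy** `Ψ`. [cite: McDuffSalamon2017, §3.2] -/
def Ψ : AmbientIsotopy (𝓡 4) N := D.exists_flow.choose

/-- The tracks of `Ψ` are integral curves of the suspended cut-off Moser field. [folklore] -/
theorem Ψ_track (y : N) : IsMIntegralCurve (I := 𝓘(ℝ, ℝ).prod (𝓡 4))
    (fun s ↦ ((s, D.Ψ.toFun s y) : ℝ × N))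
    (fun p : ℝ × N ↦ (((1 : ℝ), D.G p) : TangentSpace (𝓘(ℝ, ℝ).prod (𝓡 4)) p)) :=
  D.exists_flow.choose_spec y

/-- **The Moser isotopy fixes the surface pointwise.** [folklore] -/
theorem Ψ_b (t : ℝ) (y : S) : D.Ψ.toFun t (D.b y) = D.b y :=
  SlabFlow.apply_eq_self_of_forall_eq_zero D.contMDiff_G D.Ψ_track (fun t ↦ D.G_b t y) t

/-- `Ψ_0 = id`. [folklore] -/
theorem Ψ_zero (y : N) : D.Ψ.toFun 0 y = y := by rw [D.Ψ.map_zero]; rfl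

/-! ### The flow read in charts -/

/-- **The flow read in charts**: `Q (t, p) = φ_{x₀} (Ψ_t (φ_y⁻¹ p))`. [folklore] -/
def flowChart (x₀ y : N) (z : ℝ × E4) : E4 :=
  extChartAt (𝓡 4) x₀ (D.Ψ.toFun z.1 ((extChartAt (𝓡 4) y).symm z.2))

/-- The flow read in charts is `C^∞` where the charts apply. [folklore] -/
theorem contDiffAt_flowChart (x₀ y : N) {z : ℝ × E4} (hz : z.2 ∈ (extChartAt (𝓡 4) y).target)
    (hs : D.Ψ.toFun z.1 ((extChartAt (𝓡 4) y).symm z.2) ∈ (extChartAt (𝓡 4) x₀).source) :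
    ContDiffAt ℝ ∞ (D.flowChart x₀ y) z := by
  rw [← contMDiffAt_iff_contDiffAt]
  have h1 : ContMDiffAt 𝓘(ℝ, ℝ × E4) (𝓘(ℝ, ℝ).prod (𝓡 4)) ∞
      (fun z : ℝ × E4 ↦ ((z.1, (extChartAt (𝓡 4) y).symm z.2) : ℝ × N)) z := by
    refine ContMDiffAt.prodMk ?_ ?_
    · exact contMDiffAt_iff_contDiffAt.2 contDiffAt_fst
    · exact ((contMDiffOn_extChartAt_symm y).contMDiffAt
        ((isOpen_extChartAt_target y).mem_nhds hz)).comp z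
        (contMDiffAt_iff_contDiffAt.2 contDiffAt_snd)
  have h2 : ContMDiffAt (𝓘(ℝ, ℝ).prod (𝓡 4)) (𝓡 4) ∞ (uncurry D.Ψ.toFun)
      (z.1, (extChartAt (𝓡 4) y).symm z.2) := D.Ψ.contMDiff.contMDiffAt
  have h3 : ContMDiffAt (𝓡 4) 𝓘(ℝ, E4) ∞ (extChartAt (𝓡 4) x₀)
      (D.Ψ.toFun z.1 ((extChartAt (𝓡 4) y).symm z.2)) :=
    contMDiffAt_extChartAt' (by rwa [← extChartAt_source (𝓡 4)])
  exact h3.comp z (h2.comp z h1)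

-- the tangent spaces of `ℝ × N` are the model space `ℝ × E4` by definition, which the
-- derivative lemmas must see through (as in the tree's `GrayStabilityFlow.lean`)
set_option backward.isDefEq.respectTransparency false in
/-- Each track `s ↦ Ψ_s y` is an integral curve of the cut-off Moser field. [cite: HirschDT1976, Ch. 8 §1, Thm. 1.1] -/
theorem hasMFDerivAt_track (y : N) (s : ℝ) :
    HasMFDerivAt 𝓘(ℝ, ℝ) (𝓡 4) (fun s ↦ D.Ψ.toFun s y) s
      ((1 : ℝ →L[ℝ] ℝ).smulRight (D.G (s, D.Ψ.toFun s y))) := by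
  have htrack := D.Ψ_track y s
  have h2 := (hasMFDerivAt_snd (I := 𝓘(ℝ, ℝ)) (I' := 𝓡 4)
    (((s, D.Ψ.toFun s y) : ℝ × N))).comp s htrack
  refine h2.congr_mfderiv ?_
  rw [ContinuousLinearMap.ext_iff]
  intro r
  rw [ContinuousLinearMap.comp_apply, ContinuousLinearMap.smulRight_apply,
    ContinuousLinearMap.smulRight_apply, map_smul]
  rfl

/-- **The flow equation in a chart**: while `Ψ_s y` lies in the chart at `x₀` and in the inner
tube, and `s ∈ [-1/4, 5/4]`, `d/ds φ_{x₀}(Ψ_s y) = X̂ (s, φ_{x₀}(Ψ_s y))`. [cite: McDuffSalamon2017, §3.2] -/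
theorem hasDerivAt_extChartAt_track (x₀ y : N) {s : ℝ} (hs : s ∈ Icc (-(1 / 4) : ℝ) (5 / 4))
    (hT : D.Ψ.toFun s y ∈ D.T (D.ε₂ / 2)) (hsrc : D.Ψ.toFun s y ∈ (extChartAt (𝓡 4) x₀).source) :
    HasDerivAt (fun s ↦ extChartAt (𝓡 4) x₀ (D.Ψ.toFun s y))
      (D.Xrep x₀ (s, extChartAt (𝓡 4) x₀ (D.Ψ.toFun s y))) s := by
  have hcurve : IsTimeDepMIntegralCurveOn (I := 𝓡 4) (fun s ↦ D.Ψ.toFun s y)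
      (fun t x ↦ D.G (t, x)) univ :=
    fun t _ ↦ (D.hasMFDerivAt_track y t).hasMFDerivWithinAt
  have h := hcurve.hasDerivWithinAt (mem_univ s) hsrc
  rw [hasDerivWithinAt_univ] at h
  refine h.congr_deriv ?_
  have ht : s ∈ Itime := ⟨by linarith [hs.1], by linarith [hs.2]⟩
  rw [D.G_eq_Y (p := (s, D.Ψ.toFun s y)) hs (D.T_subset_Tbar _ hT), Xrep,
    D.tangentCoordChange_Y x₀ ht (D.Tin_subset_O₂ hT) hsrc]

/-- The flow equation for the flow read in charts: `∂_t Q = X̂ (t, Q)`. [cite: McDuffSalamon2017, §3.2] -/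
theorem fderiv_flowChart_eq (x₀ y : N) {z : ℝ × E4} (ht : z.1 ∈ Icc (-(1 / 4) : ℝ) (5 / 4))
    (hz : z.2 ∈ (extChartAt (𝓡 4) y).target)
    (hT : D.Ψ.toFun z.1 ((extChartAt (𝓡 4) y).symm z.2) ∈ D.T (D.ε₂ / 2))
    (hs : D.Ψ.toFun z.1 ((extChartAt (𝓡 4) y).symm z.2) ∈ (extChartAt (𝓡 4) x₀).source) :
    fderiv ℝ (D.flowChart x₀ y) z (1, 0) = D.Xrep x₀ (z.1, D.flowChart x₀ y z) := by
  obtain ⟨t, p⟩ := z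
  have hd : HasFDerivAt (D.flowChart x₀ y) (fderiv ℝ (D.flowChart x₀ y) (t, p)) (t, p) :=
    ((D.contDiffAt_flowChart x₀ y hz hs).differentiableAt (by simp)).hasFDerivAt
  have hc₁ : HasDerivAt (fun s : ℝ ↦ ((s, p) : ℝ × E4)) ((1 : ℝ), (0 : E4)) t :=
    (hasDerivAt_id t).prodMk (hasDerivAt_const t p)
  have h1 : HasDerivAt ((D.flowChart x₀ y) ∘ fun s : ℝ ↦ ((s, p) : ℝ × E4))
      (fderiv ℝ (D.flowChart x₀ y) (t, p) (1, 0)) t := hd.comp_hasDerivAt t hc₁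
  have h2 : HasDerivAt (fun s ↦ D.flowChart x₀ y (s, p))
      (D.Xrep x₀ (t, D.flowChart x₀ y (t, p))) t :=
    D.hasDerivAt_extChartAt_track x₀ _ ht hT hs
  exact h1.unique h2

-- `mfderiv` is an `fderiv` between tangent spaces, which are the model space by definition
set_option backward.isDefEq.respectTransparency false in
/-- **The pairing `s_t (Ψ_t y) [TΨ_t v, TΨ_t w]` is the transported pairing in charts.** [folklore] -/
theorem pairing₂_eq_trackPairing₂ (x₀ y : N) (v w : E4) {t : ℝ}
    (ht : D.Ψ.toFun t y ∈ (extChartAt (𝓡 4) x₀).source) :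
    D.sFam t (D.Ψ.toFun t y) ![mfderiv (𝓡 4) (𝓡 4) (D.Ψ.toFun t) y v,
      mfderiv (𝓡 4) (𝓡 4) (D.Ψ.toFun t) y w] =
      OrigamiMoser.trackPairing₂ (D.Arep x₀) (D.flowChart x₀ y) (extChartAt (𝓡 4) y y) v w t := by
  set xt := D.Ψ.toFun t y with hxt
  have hp₀ : extChartAt (𝓡 4) y y ∈ (extChartAt (𝓡 4) y).target := mem_extChartAt_target y
  have hy : (extChartAt (𝓡 4) y).symm (extChartAt (𝓡 4) y y) = y := extChartAt_to_inv y
  have hQ0 : D.flowChart x₀ y (t, extChartAt (𝓡 4) y y) = extChartAt (𝓡 4) x₀ xt := by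
    rw [flowChart, hy]
  have hs : D.Ψ.toFun t ((extChartAt (𝓡 4) y).symm (extChartAt (𝓡 4) y y)) ∈
      (extChartAt (𝓡 4) x₀).source := by rwa [hy]
  have hQfull : DifferentiableAt ℝ (D.flowChart x₀ y) (t, extChartAt (𝓡 4) y y) :=
    (D.contDiffAt_flowChart x₀ y hp₀ hs).differentiableAt (by simp)
  have hQt : HasFDerivAt (fun p ↦ D.flowChart x₀ y (t, p))
      ((fderiv ℝ (D.flowChart x₀ y) (t, extChartAt (𝓡 4) y y)).comp
        (ContinuousLinearMap.inr ℝ ℝ E4)) (extChartAt (𝓡 4) y y) :=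
    hQfull.hasFDerivAt.comp _ (hasFDerivAt_prodMk_right t _)
  -- the manifold derivative as the derivative of the written map
  have hmd : MDifferentiableAt (𝓡 4) (𝓡 4) (D.Ψ.toFun t) y :=
    ((D.Ψ.contMDiff_toFun t) y).mdifferentiableAt (by simp)
  rw [hmd.mfderiv, ModelWithCorners.range_eq_univ, fderivWithin_univ]
  have hev : writtenInExtChartAt (𝓡 4) (𝓡 4) y (D.Ψ.toFun t) =ᶠ[𝓝 (extChartAt (𝓡 4) y y)]
      (extChartAt (𝓡 4) xt ∘ (extChartAt (𝓡 4) x₀).symm) ∘ fun p ↦ D.flowChart x₀ y (t, p) := by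
    have hcont : ContinuousAt (fun p ↦ D.Ψ.toFun t ((extChartAt (𝓡 4) y).symm p))
        (extChartAt (𝓡 4) y y) :=
      ((D.Ψ.contMDiff_toFun t).continuous.continuousAt).comp (continuousAt_extChartAt_symm y)
    have hmem : ∀ᶠ p in 𝓝 (extChartAt (𝓡 4) y y),
        D.Ψ.toFun t ((extChartAt (𝓡 4) y).symm p) ∈ (extChartAt (𝓡 4) x₀).source :=
      hcont.preimage_mem_nhds ((isOpen_extChartAt_source x₀).mem_nhds hs)
    filter_upwards [hmem] with p hp
    simp only [writtenInExtChartAt, flowChart, comp_apply]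
    rw [(extChartAt (𝓡 4) x₀).left_inv hp]
  rw [hev.fderiv_eq]
  have hT : HasFDerivAt (extChartAt (𝓡 4) xt ∘ (extChartAt (𝓡 4) x₀).symm)
      (tangentCoordChange (𝓡 4) x₀ xt xt) (D.flowChart x₀ y (t, extChartAt (𝓡 4) y y)) := by
    have h := hasFDerivWithinAt_tangentCoordChange (I := 𝓡 4) (x := x₀) (y := xt) (z := xt)
      ⟨ht, mem_extChartAt_source xt⟩
    rwa [ModelWithCorners.range_eq_univ, hasFDerivWithinAt_univ, ← hQ0] at h
  rw [(hT.comp (extChartAt (𝓡 4) y y) hQt).fderiv]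
  change (D.sFam t xt) ![tangentCoordChange (𝓡 4) x₀ xt xt
    (fderiv ℝ (D.flowChart x₀ y) (t, extChartAt (𝓡 4) y y) ((0 : ℝ), v)),
    tangentCoordChange (𝓡 4) x₀ xt xt
    (fderiv ℝ (D.flowChart x₀ y) (t, extChartAt (𝓡 4) y y) ((0 : ℝ), w))] = _
  -- the right-hand side
  rw [OrigamiMoser.trackPairing₂, hQ0, Arep]
  dsimp only
  rw [MForm.inChart_eq_of_mem_target _ ((extChartAt (𝓡 4) x₀).map_source ht),
    (extChartAt (𝓡 4) x₀).left_inv ht, ContinuousAlternatingMap.compContinuousLinearMap_apply]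
  congr 1
  funext i; fin_cases i <;> rfl

/-! ### Invariance of the pairing along the flow -/

/-- The good times: where the time cut-off is `1` nearby. [folklore] -/
abbrev Igood : Set ℝ := Ioo (-(1 / 4) : ℝ) (5 / 4)

/-- **Local form of Moser's theorem along one track**: for `t₀ ∈ (-1/4, 5/4)` with `Ψ_{t₀} y` in
the inner tube, the pairing `f(t) = s_t (Ψ_t y) [TΨ_t v, TΨ_t w]` has `f'(t₀) = 0`.
[cite: McDuffSalamon2017, §3.2] -/
theorem hasDerivAt_pairing₂ (y : N) (v w : E4) {t₀ : ℝ} (ht₀ : t₀ ∈ Igood)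
    (hy : D.Ψ.toFun t₀ y ∈ D.T (D.ε₂ / 2)) :
    HasDerivAt (fun t ↦ D.sFam t (D.Ψ.toFun t y) ![mfderiv (𝓡 4) (𝓡 4) (D.Ψ.toFun t) y v,
      mfderiv (𝓡 4) (𝓡 4) (D.Ψ.toFun t) y w]) 0 t₀ := by
  -- notation: `x₀ = Ψ_{t₀} y` (centre of the chart), `p₀ = φ_y y`, `Q = flowChart x₀ y`
  set x₀ := D.Ψ.toFun t₀ y with hx₀
  have hp₀ : extChartAt (𝓡 4) y y ∈ (extChartAt (𝓡 4) y).target := mem_extChartAt_target y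
  have hyy : (extChartAt (𝓡 4) y).symm (extChartAt (𝓡 4) y y) = y := extChartAt_to_inv y
  have htrack : Continuous fun t ↦ D.Ψ.toFun t y :=
    D.Ψ.contMDiff.continuous.comp (continuous_id.prodMk continuous_const)
  have hQp₀ : ∀ t, D.flowChart x₀ y (t, extChartAt (𝓡 4) y y) = extChartAt (𝓡 4) x₀ (D.Ψ.toFun t y) :=
    fun t ↦ by rw [flowChart, hyy]
  have hq₀ : D.flowChart x₀ y (t₀, extChartAt (𝓡 4) y y) = extChartAt (𝓡 4) x₀ x₀ := hQp₀ t₀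
  have hx₀O : x₀ ∈ D.O₂ := D.Tin_subset_O₂ hy
  have hx₀q : extChartAt (𝓡 4) x₀ x₀ ∈ D.tgtq x₀ := ⟨mem_extChartAt_target x₀, by
    show (extChartAt (𝓡 4) x₀).symm (extChartAt (𝓡 4) x₀ x₀) ∈ D.Tq
    rw [extChartAt_to_inv]; exact D.O₂_subset_Tq hx₀O⟩
  have hsy : D.Ψ.toFun t₀ ((extChartAt (𝓡 4) y).symm (extChartAt (𝓡 4) y y)) ∈
      (extChartAt (𝓡 4) x₀).source := by
    rw [hyy]; exact mem_extChartAt_source x₀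
  have ht₀' : t₀ ∈ Itime := ⟨by linarith [ht₀.1], by linarith [ht₀.2]⟩
  -- the derivative of the transported pairing at `t₀`
  have hder : HasDerivAt (OrigamiMoser.trackPairing₂ (D.Arep x₀) (D.flowChart x₀ y)
      (extChartAt (𝓡 4) y y) v w) 0 t₀ := by
    refine OrigamiMoser.hasDerivAt_trackPairing₂ (X := D.Xrep x₀) (Mu := D.Mrep x₀) v w
      ?_ ?_ ?_ ?_ ?_ ?_ ?_ ?_
    · rw [hq₀]
      exact (D.contDiffAt_Arep x₀ (D.tgtq_subset_tgt₁ x₀ hx₀q)).of_le (by norm_cast)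
    · rw [hq₀]
      exact (D.contDiffAt_Mrep x₀ hx₀q).of_le (by norm_cast)
    · rw [hq₀]
      refine (D.contDiffAt_moserChart x₀ (p := (t₀, extChartAt (𝓡 4) x₀ x₀)) ht₀' hx₀q ?_).of_le
        (by norm_cast)
      show (extChartAt (𝓡 4) x₀).symm (extChartAt (𝓡 4) x₀ x₀) ∈ D.O₂
      rw [extChartAt_to_inv]; exact hx₀O
    · exact (D.contDiffAt_flowChart x₀ y hp₀ hsy).of_le (by norm_cast)
    · -- the flow equation near `(t₀, p₀)`
      have hcont : ContinuousOn (fun z : ℝ × E4 ↦ D.Ψ.toFun z.1 ((extChartAt (𝓡 4) y).symm z.2))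
          (univ ×ˢ (extChartAt (𝓡 4) y).target) :=
        D.Ψ.contMDiff.continuous.comp_continuousOn (continuousOn_fst.prodMk
          ((continuousOn_extChartAt_symm y).comp continuousOn_snd (fun z hz ↦ hz.2)))
      have hopen : IsOpen ((univ ×ˢ (extChartAt (𝓡 4) y).target) ∩
          (fun z : ℝ × E4 ↦ D.Ψ.toFun z.1 ((extChartAt (𝓡 4) y).symm z.2)) ⁻¹'
            ((extChartAt (𝓡 4) x₀).source ∩ D.T (D.ε₂ / 2))) :=
        hcont.isOpen_inter_preimage (isOpen_univ.prod (isOpen_extChartAt_target y))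
          ((isOpen_extChartAt_source _).inter (D.isOpen_T _))
      have hmem : ((t₀, extChartAt (𝓡 4) y y) : ℝ × E4) ∈
          (univ ×ˢ (extChartAt (𝓡 4) y).target) ∩
          (fun z : ℝ × E4 ↦ D.Ψ.toFun z.1 ((extChartAt (𝓡 4) y).symm z.2)) ⁻¹'
            ((extChartAt (𝓡 4) x₀).source ∩ D.T (D.ε₂ / 2)) := by
        refine ⟨⟨mem_univ _, hp₀⟩, ?_⟩
        show D.Ψ.toFun t₀ ((extChartAt (𝓡 4) y).symm (extChartAt (𝓡 4) y y)) ∈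
          (extChartAt (𝓡 4) x₀).source ∩ D.T (D.ε₂ / 2)
        rw [hyy]; exact ⟨mem_extChartAt_source x₀, hy⟩
      have htime : ∀ᶠ z : ℝ × E4 in 𝓝 (t₀, extChartAt (𝓡 4) y y), z.1 ∈ Igood :=
        continuousAt_fst.preimage_mem_nhds (isOpen_Ioo.mem_nhds ht₀)
      filter_upwards [hopen.mem_nhds hmem, htime] with z hz hzt
      exact D.fderiv_flowChart_eq x₀ y (Ioo_subset_Icc_self hzt) hz.1.2 hz.2.2 hz.2.1
    · -- the Moser equation near `(t₀, φ x₀)`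
      have hopen : IsOpen (Ioo (-1 : ℝ) 2 ×ˢ ((extChartAt (𝓡 4) x₀).target ∩
          (extChartAt (𝓡 4) x₀).symm ⁻¹' D.O₂)) :=
        isOpen_Ioo.prod ((continuousOn_extChartAt_symm x₀).isOpen_inter_preimage
          (isOpen_extChartAt_target x₀) D.isOpen_O₂)
      have hmem : ((t₀, D.flowChart x₀ y (t₀, extChartAt (𝓡 4) y y)) : ℝ × E4) ∈
          Ioo (-1 : ℝ) 2 ×ˢ ((extChartAt (𝓡 4) x₀).target ∩ (extChartAt (𝓡 4) x₀).symm ⁻¹' D.O₂) := by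
        rw [hq₀]
        refine ⟨⟨by linarith [ht₀.1], by linarith [ht₀.2]⟩, mem_extChartAt_target x₀, ?_⟩
        show (extChartAt (𝓡 4) x₀).symm (extChartAt (𝓡 4) x₀ x₀) ∈ D.O₂
        rw [extChartAt_to_inv]; exact hx₀O
      filter_upwards [hopen.mem_nhds hmem] with z hz u
      exact D.Arep_Xrep x₀ (Ioo_subset_Icc_self hz.1) hz.2.1 hz.2.2 u
    · intro a b'
      rw [hq₀]
      exact D.Arep_dot x₀ hx₀q a b'
    · intro a b' c
      rw [hq₀]
      exact D.Arep_closed x₀ (D.tgtq_subset_tgt₁ x₀ hx₀q) a b' c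
  -- transfer to the pairing on the manifold, near `t₀`
  have hT1 : ∀ᶠ t in 𝓝 t₀, D.Ψ.toFun t y ∈ (extChartAt (𝓡 4) x₀).source :=
    htrack.continuousAt.preimage_mem_nhds ((isOpen_extChartAt_source x₀).mem_nhds
      (mem_extChartAt_source x₀))
  have hev : (fun t ↦ D.sFam t (D.Ψ.toFun t y) ![mfderiv (𝓡 4) (𝓡 4) (D.Ψ.toFun t) y v,
      mfderiv (𝓡 4) (𝓡 4) (D.Ψ.toFun t) y w]) =ᶠ[𝓝 t₀]
      OrigamiMoser.trackPairing₂ (D.Arep x₀) (D.flowChart x₀ y) (extChartAt (𝓡 4) y y) v w := by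
    filter_upwards [hT1] with s hs
    exact D.pairing₂_eq_trackPairing₂ x₀ y v w hs
  exact hder.congr_of_eventuallyEq hev

/-- **The good starting set** `O₄`: points whose track stays in the inner tube during `[0, 1]`.
[folklore] -/
def O₄ : Set N := {y | ∀ t ∈ Icc (0 : ℝ) 1, D.Ψ.toFun t y ∈ D.T (D.ε₂ / 2)}

/-- `O₄` is open (tube lemma over the compact time interval). [folklore] -/
theorem isOpen_O₄ : IsOpen D.O₄ := by
  rw [isOpen_iff_mem_nhds]
  intro y hy
  have hcont : Continuous (uncurry D.Ψ.toFun) := D.Ψ.contMDiff.continuous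
  have hopen : IsOpen ((uncurry D.Ψ.toFun) ⁻¹' D.T (D.ε₂ / 2)) := (D.isOpen_T _).preimage hcont
  have hsub : Icc (0 : ℝ) 1 ×ˢ ({y} : Set N) ⊆ (uncurry D.Ψ.toFun) ⁻¹' D.T (D.ε₂ / 2) := by
    rintro ⟨t, y'⟩ ⟨ht, hy'⟩
    rw [mem_singleton_iff] at hy'
    subst hy'
    exact hy t ht
  obtain ⟨u, v, -, hv, hIu, hyv, huv⟩ :=
    generalized_tube_lemma isCompact_Icc isCompact_singleton hopen hsub
  refine mem_of_superset (hv.mem_nhds (hyv (mem_singleton y))) fun y' hy' t ht ↦ ?_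
  have hmem : ((t, y') : ℝ × N) ∈ u ×ˢ v := ⟨hIu ht, hy'⟩
  exact huv hmem

/-- The surface lies in `O₄` (it is fixed by the flow). [folklore] -/
theorem b_mem_O₄ (y : S) : D.b y ∈ D.O₄ := fun t _ ↦ by
  rw [D.Ψ_b]; exact D.b_mem_T (half_pos D.ε₂_pos) y

/-- The surface lies in `O₄`. [folklore] -/
theorem range_b_subset_O₄ : range D.b ⊆ D.O₄ := by
  rintro _ ⟨y, rfl⟩; exact D.b_mem_O₄ y

/-- `O₄` lies in the inner tube (time `0`). [folklore] -/
theorem O₄_subset_T {y : N} (hy : y ∈ D.O₄) : y ∈ D.T (D.ε₂ / 2) := by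
  have h := hy 0 ⟨le_rfl, zero_le_one⟩
  rwa [D.Ψ_zero] at h

/-- `O₄ ⊆ Tq`. [folklore] -/
theorem O₄_subset_Tq {y : N} (hy : y ∈ D.O₄) : y ∈ D.Tq :=
  D.O₂_subset_Tq (D.Tin_subset_O₂ (D.O₄_subset_T hy))

-- `mfderiv` of the identity, between tangent spaces which are the model space by definition
set_option backward.isDefEq.respectTransparency false in
/-- **Moser's theorem on the tube**: for `y ∈ O₄`,
`s (Ψ₁ y) [TΨ₁ v, TΨ₁ w] = s_M y [v, w]` (`Ψ₁^* s = s_M` near the surface).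
[cite: McDuffSalamon2017, §3.2, Thm. 3.4.10] -/
theorem moser_pullback {y : N} (hy : y ∈ D.O₄) (v w : E4) :
    D.s (D.Ψ.toFun 1 y) ![mfderiv (𝓡 4) (𝓡 4) (D.Ψ.toFun 1) y v,
      mfderiv (𝓡 4) (𝓡 4) (D.Ψ.toFun 1) y w] = D.sM y ![v, w] := by
  set f : ℝ → ℝ := fun t ↦ D.sFam t (D.Ψ.toFun t y) ![mfderiv (𝓡 4) (𝓡 4) (D.Ψ.toFun t) y v,
    mfderiv (𝓡 4) (𝓡 4) (D.Ψ.toFun t) y w] with hf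
  have hderiv : ∀ t ∈ Icc (0 : ℝ) 1, HasDerivAt f 0 t := fun t ht ↦
    D.hasDerivAt_pairing₂ y v w ⟨by linarith [ht.1], by linarith [ht.2]⟩ (hy t ht)
  have hcont : ContinuousOn f (Icc 0 1) := fun t ht ↦ (hderiv t ht).continuousAt.continuousWithinAt
  have hconst := constant_of_has_deriv_right_zero hcont
    (fun t ht ↦ (hderiv t (Ico_subset_Icc_self ht)).hasDerivWithinAt) 1 ⟨zero_le_one, le_rfl⟩
  -- `f 1 = s (Ψ₁ y) [...]`, `f 0 = s_M y [v, w]`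
  have h1 : f 1 = D.s (D.Ψ.toFun 1 y) ![mfderiv (𝓡 4) (𝓡 4) (D.Ψ.toFun 1) y v,
      mfderiv (𝓡 4) (𝓡 4) (D.Ψ.toFun 1) y w] := by
    simp only [hf, D.sFam_one]
  have h0 : f 0 = D.sM y ![v, w] := by
    simp only [hf, D.sFam_zero]
    rw [D.Ψ.map_zero, mfderiv_id]
    rfl
  rw [← h1, hconst, h0]

end Flow

end Setup

end SurfaceTube

end Literature.Geometry.Symplectic
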